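import Summits.BirchSwinnertonDyer.BirchSwinnertonDyer.Theorems.SchneiderFreeAdditiveX3PoitouTateShaTwoLocalGlobalReal
import Summits.BirchSwinnertonDyer.BirchSwinnertonDyer.Theorems.ThetaPartnerAtTwoSignedControlAtTwoShaTwoOfBridgeOfLocalGlobal
import Summits.BirchSwinnertonDyer.BirchSwinnertonDyer.Theorems.SchneiderFreeAdditiveX3PoitouTateReciprocityEquality
import HarnessLib

/-!
# PT (ii) `poitouTate_sha_tateDual K` at EVERY number field `K` from the bridge (nat, R4=) ALONE, and from the ONE named input
# `hRur` (local readouts of an idèle-valued map are unramified almost everywhere)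

Cell `bsd-schneider-ideate`, seat `bsd-schneider-door-c4` (prover, generation 19).  PARTITION: board row B6 ∩ X3 ∩ sst-twist,
`r = 1`, of `Rank1Residual.partition` — CONTROL corner (crux `AnticycControlAdditiveK`, item 19295; facts binder `ControlFacts`,
item 19538, conjunct (ii) = `∀ K, poitouTate_sha_tateDual K`).  bears_on: K1-door (items 18969 → 19295, 19538).

Assembly only, over landed files:
* `poitouTate_sha_tateDual_of_R4` — PT (ii) at ANY `K` from the bridge hypothesis `hR4` (shape of bsd-inputs-k4-p1's
  `poitouTate_sha_tateDual_of_bridge_of_localGlobal'`) ALONE: hypothesis (A) is now the theorem `tateDual_localGlobal_real`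
  (door-c4 g19, `…ShaTwoLocalGlobalReal`), `SelmerComplement` is door-c4 g18's `selmerComplement_canonical_holds`, (B) is
  door-c5 g18's `sha_hom_units_dies_in_idele`, Ψ is bsd-line-chl-p2's.
* `hR4_of_readoutUnramified` — the bridge from door-c5 g18's `hR4_ideleProjection_of_readoutUnramified` + `nat_bijective` +
  door-c6's biduality pair `exists_bidual_intertwining`, modulo `hRur`.
* **`poitouTate_sha_tateDual_of_readoutUnramified (hRur) : poitouTate_sha_tateDual K`** — PT (ii) at every `K` from `hRur` ALONE.

HONEST FRAMING: CONDITIONAL on the one named input `hRur` (Milne I Lemma 4.13, `v ∉ T` factor; door-c5 g18 owns its proof);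
no case of BSD is proved; «closes rung: none».
References: [MilneADT2006] I Thm. 4.10 (a) (proof, p. 58), Lemma 4.13; [Harari2020] Thm. 17.13 (b).
-/

noncomputable section

open Function NumberField IsDedekindDomain CategoryTheory
open scoped NumberField ContRepresentation

-- `Summit.<P>.<Sub>` repeats `BirchSwinnertonDyer` by the tree's layout convention (D-0017)
set_option linter.dupNamespace false

namespace Summit.BirchSwinnertonDyer.BirchSwinnertonDyer.Theorems.SchneiderFreeAdditiveX3.PoitouTateReduction

open Field
open Literature.NumberTheory.GaloisRepresentations Literature.NumberTheory.GaloisCohomology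
open Literature.NumberTheory.GaloisRepresentations.DiscreteGaloisModule (TateDual tateDual units shaTwo unramifiedSubgroup
  localTatePairingZMod)
open Literature.Algebra.Homology Literature.Algebra.Homology.DiscreteRep Literature.Algebra.Homology.ExtPresentation
open Literature.NumberTheory.GaloisRepresentations.IdeleClassBar (classBarD classBarInv)
open Literature.AnabelianGeometry.AbsoluteAnabelian.Prop121vii (zmodToQmodZ)
open Literature.NumberTheory.GaloisRepresentations.FreePresentation (presentationComplex presentationComplex_shortExact
  presModule₂ presProj moduleFinite_presModule₂)
open Literature.NumberTheory.GaloisRepresentations.HomDual (readout dualF tateDualUnitsIso)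
open Literature.NumberTheory.GaloisRepresentations.IdeleReadout (ideleProjection)
open Literature.NumberTheory.GaloisRepresentations.OpenLayer (extOneEquiv)
open Summit.BirchSwinnertonDyer.BirchSwinnertonDyer.Theorems.PoitouTateShaTwoReadout
  (poitouTate_sha_tateDual_of_bridge_of_localGlobal' tateDual_localGlobal_real)

variable {K : Type} [Field K] [NumberField K]

/-- **PT (ii) at ANY number field `K` from the bridge (nat, R4=) ALONE**: hypothesis (A) of
`poitouTate_sha_tateDual_of_bridge_of_localGlobal'` is the theorem `tateDual_localGlobal_real` (no `IsTotallyComplex`).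
CONDITIONAL on `hR4`; no case of BSD is proved. [cite: MilneADT2006, I Thm. 4.10 (a) (proof, p. 58)] -/
theorem poitouTate_sha_tateDual_of_R4
    (hR4 : ∀ (n : ℕ) [NeZero n],
      ∀ ⦃M : Type⦄ [AddCommGroup M] [TopologicalSpace M] [DiscreteTopology M] [Finite M] [Finite (TateDual K M n)]
      (ρ₀ : DiscreteGaloisModule K M) (hM : ∀ m : M, n • m = 0),
      ∃ nat : galoisCohomology ((ρ₀.tateDual n).tateDual n) 1 →+
          Abelian.Ext (triv (Γ := absoluteGaloisGroup K) ℤ) (presentationComplex ρ₀).X₃ 1,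
        Function.Bijective nat ∧
        ∀ f : (presentationComplex ρ₀).X₁ ⟶ (ideleClassLimitShortComplex K).X₂, ∃ Tf : Finset (Place K),
          ∀ (y : galoisCohomology ((ρ₀.tateDual n).tateDual n) 1) (T' : Finset (Place K)), Tf ⊆ T' →
            (∀ v : HeightOneSpectrum (𝓞 K), (Sum.inr v : Place K) ∉ T' →
              galoisCohomology.localization ((ρ₀.tateDual n).tateDual n) (Sum.inr v) 1 y ∈
                unramifiedSubgroup (GaloisRep.toLocal v ((ρ₀.tateDual n).tateDual n)) 1) →
            zmodToQmodZ n (∑ v ∈ T', localTatePairingZMod (ρ₀.tateDual n) n v (LocalInvariants.canonical K n v)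
              (readout ρ₀ n hM (ideleProjection K v) f)
              (galoisCohomology.localization ((ρ₀.tateDual n).tateDual n) v 1 y)) =
            classBarInv K ((nat y).comp (boundary (presentationComplex_shortExact ρ₀) (classBarD K)
              (f ≫ (ideleClassLimitShortComplex K).g)) (rfl : 1 + 1 = 2))) :
    poitouTate_sha_tateDual K :=
  poitouTate_sha_tateDual_of_bridge_of_localGlobal' hR4 fun n _ _ _ _ _ _ ρ₀ hM => tateDual_localGlobal_real ρ₀ n hM

/-- **The bridge (nat, R4=) from the ONE named input `hRur`**: `nat := −(Φ⁻¹ ∘ H¹(κ))` for a biduality pair `(ι, κ)`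
(`exists_bidual_intertwining`), bijective (`nat_bijective`), with the reciprocity equality
`hR4_ideleProjection_of_readoutUnramified` (door-c5 g18).  CONDITIONAL on `hRur`; no case of BSD is proved.
[cite: MilneADT2006, I Thm. 4.10 (a) (proof, p. 58), Lemma 4.13] -/
theorem hR4_of_readoutUnramified
    (hRur : ∀ (n : ℕ) [NeZero n],
      ∀ ⦃M : Type⦄ [AddCommGroup M] [TopologicalSpace M] [DiscreteTopology M] [Finite M]
      (ρ₀ : DiscreteGaloisModule K M) (hM : ∀ m : M, n • m = 0)
      (f : (presentationComplex ρ₀).X₁ ⟶ (ideleClassLimitShortComplex K).X₂), ∃ Tf : Finset (Place K),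
        ∀ v : HeightOneSpectrum (𝓞 K), (Sum.inr v : Place K) ∉ Tf →
          ((n : ℕ) : 𝓞 K) ∉ v.asIdeal ∧ GaloisRep.IsUnramifiedAt v (ρ₀.tateDual n) ∧
            readout ρ₀ n hM (ideleProjection K (Sum.inr v)) f ∈
              unramifiedSubgroup (GaloisRep.toLocal v (ρ₀.tateDual n)) 1)
    (n : ℕ) [NeZero n]
    ⦃M : Type⦄ [AddCommGroup M] [TopologicalSpace M] [DiscreteTopology M] [Finite M] [Finite (TateDual K M n)]
    (ρ₀ : DiscreteGaloisModule K M) (hM : ∀ m : M, n • m = 0) :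
    ∃ nat : galoisCohomology ((ρ₀.tateDual n).tateDual n) 1 →+
        Abelian.Ext (triv (Γ := absoluteGaloisGroup K) ℤ) (presentationComplex ρ₀).X₃ 1,
      Function.Bijective nat ∧
      ∀ f : (presentationComplex ρ₀).X₁ ⟶ (ideleClassLimitShortComplex K).X₂, ∃ Tf : Finset (Place K),
        ∀ (y : galoisCohomology ((ρ₀.tateDual n).tateDual n) 1) (T' : Finset (Place K)), Tf ⊆ T' →
          (∀ v : HeightOneSpectrum (𝓞 K), (Sum.inr v : Place K) ∉ T' →
            galoisCohomology.localization ((ρ₀.tateDual n).tateDual n) (Sum.inr v) 1 y ∈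
              unramifiedSubgroup (GaloisRep.toLocal v ((ρ₀.tateDual n).tateDual n)) 1) →
          zmodToQmodZ n (∑ v ∈ T', localTatePairingZMod (ρ₀.tateDual n) n v (LocalInvariants.canonical K n v)
            (readout ρ₀ n hM (ideleProjection K v) f)
            (galoisCohomology.localization ((ρ₀.tateDual n).tateDual n) v 1 y)) =
          classBarInv K ((nat y).comp (boundary (presentationComplex_shortExact ρ₀) (classBarD K)
            (f ≫ (ideleClassLimitShortComplex K).g)) (rfl : 1 + 1 = 2)) := by
  obtain ⟨ι, κ, hι, hκι, hικ⟩ := exists_bidual_intertwining (n := n) ρ₀ hM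
  exact ⟨_, nat_bijective ρ₀ ι κ hκι hικ,
    hR4_ideleProjection_of_readoutUnramified ρ₀ hM ι κ hι hκι hικ (hRur n ρ₀ hM)⟩

/-- **PT (ii) `poitouTate_sha_tateDual K` at EVERY number field `K` from the ONE named input `hRur` ALONE** (every other
input of Milne I Thm. 4.10 (a) on door-c4's canonical presentation is a tree theorem: Tate duality for `(Γ_K, C̄)`, the
idèle projections with (R3), `SelmerComplement`, (A) at every `K`, (B), Ψ, and the (R4) equality modulo `hRur`).
CONDITIONAL on `hRur`; no case of BSD is proved. [cite: MilneADT2006, I Thm. 4.10 (a) (proof, p. 58), Lemma 4.13]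
[cite: Harari2020, Thm. 17.13 (b)] -/
theorem poitouTate_sha_tateDual_of_readoutUnramified
    (hRur : ∀ (n : ℕ) [NeZero n],
      ∀ ⦃M : Type⦄ [AddCommGroup M] [TopologicalSpace M] [DiscreteTopology M] [Finite M]
      (ρ₀ : DiscreteGaloisModule K M) (hM : ∀ m : M, n • m = 0)
      (f : (presentationComplex ρ₀).X₁ ⟶ (ideleClassLimitShortComplex K).X₂), ∃ Tf : Finset (Place K),
        ∀ v : HeightOneSpectrum (𝓞 K), (Sum.inr v : Place K) ∉ Tf →
          ((n : ℕ) : 𝓞 K) ∉ v.asIdeal ∧ GaloisRep.IsUnramifiedAt v (ρ₀.tateDual n) ∧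
            readout ρ₀ n hM (ideleProjection K (Sum.inr v)) f ∈
              unramifiedSubgroup (GaloisRep.toLocal v (ρ₀.tateDual n)) 1) :
    poitouTate_sha_tateDual K :=
  poitouTate_sha_tateDual_of_R4 fun n _ _ _ _ _ _ _ ρ₀ hM => hR4_of_readoutUnramified hRur n ρ₀ hM

end Summit.BirchSwinnertonDyer.BirchSwinnertonDyer.Theorems.SchneiderFreeAdditiveX3.PoitouTateReduction

end
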